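import Summits.HodgeConjecture.CorCM.Model.CorrespondenceAlgebraic
import Summits.HodgeConjecture.CorCM.Model.FourierSum
import HarnessLib

/-!
# COR-CM model layer, part 7c (row M22 `Fact_algDuality`, clause (i) at the socket): the Fourier-type word
# sum `Model.fourierSum` maps rational algebraic classes to rational algebraic classes

Cell `pub-hodgecm2` (COR-CM), seat `b17` (kernel K-c).  The cell's M22 INTERFACE v1 (model-1, 2026-08-20T19:10:29Z)
fixes ONE shared operator for the three sub-kernels of row M22: `Model.fourierSum hX x y i h`,
`z ↦ Σ_{c : Fin i → Fin N} tr_X(z ∪ m_i(x ∘ c)) • m_i(y ∘ c)` (`CorCM/Model/FourierSum.lean`; `m_i = cupPowOne ℚ X(ℂ) i`,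
`tr_X = BettiUniverse.tr hX (2n)`, the cup product `cupProduct h` INTO the top degree `2n`, `h : j + i = 2n`), and
assigns clause (i) of `Fact_algDuality` — «`z ∈ alg X p → fourierSum hX b y i h z ∈ alg X q` from `halg`» — to
kernel K-c.  THIS FILE proves exactly that, from part 7 (`CorCM/Model/CorrespondenceAlgebraic`, K-c:
`fourierSum_mem_ratAlgebraicClasses`) and the hypothesis `halg` in the literal output shape of kernel K-b
(`Model.sum_pull_cupPowOne_cup_mem_ratAlgebraicClasses`, `CorCM/Model/PoincareClass.lean`, seat b16):

  `halg : Σ_{c : Fin (2q) → Fin N} bettiCup (two_mul (2q)).symm (fst^* m_{2q}(x ∘ c)) (snd^* m_{2q}(y ∘ c)) ∈ alg (X ⊗ X) (2q)`.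

* `tr_cupProduct_congr` — the light trace of a cup product does not depend on the spelling of the top degree
  (`tr_X k (cupProduct hk z w) = tr_X (i+j) (z ∪ w)` for `hk : i + j = k`);
* `fourierSum_mem_ratAlgebraicClasses_of_sum_mem` — part 7's Fourier-sum theorem with the cross products formed
  INTO a prescribed degree `k` and a prescribed coniveau `e` (`2j + 2s = k`, `j + s = e`; transport by `subst`);
* `fourierSum_mem_ratAlgebraicClasses_of_halg`, `ratAlgebraicClasses_map_fourierSum_le_of_halg` — **clause (i) at
  the socket**: for `X` smooth projective of dimension `n`, families `x y : Fin N → H¹(X(ℂ); ℚ)`, degrees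
  `2p + 2q = 2n` and `halg` as displayed, `(alg X p).map (fourierSum hX x y (2q) h) ≤ alg X q`.
  For row M22: `X = P` (scheme of `prod4`), `p = dim P − 2`, `q = 2`, `i = 2·2 = 4`; the numerals `4`/`2·2`,
  `2·4`/`4+4` and `x ∘ c`/`fun k ↦ x (c k)` agree definitionally, so K-a applies these with `(q := 2)` to its
  `D := fourierSum (Var.isSmoothProjective hU h₃ P) b y 4 h` and b16's `halg` verbatim.

Print shape: Beauville, LNM 1016 (1983) Prop. 1 / Lange (2023) §6.2.4 «`F ∘ cl = cl ∘ F`», Prop. 6.2.20;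
Kleiman (1968) 2A11.  Here: a corollary of part 7.  No definitions; no named facts; explicit binders.
-/

noncomputable section

open CategoryTheory MonoidalCategory CartesianMonoidalCategory
open Literature.AlgebraicTopology.SingularHomology
open Literature.AlgebraicGeometry.Motives (SchemeOver ComplexPoints IsSmoothProjective bettiCohomology bettiCup)
open Literature.AlgebraicGeometry.HodgeTheory
open Literature.NumberTheory.Automorphic.PicardCM

namespace Summit.HodgeConjecture.CorCM.Model

section Socket

variable {n m : ℕ} {X Y : SchemeOver ℂ}

/-- The light trace of a cup product is insensitive to the spelling of the top degree:
`tr_X k (cupProduct hk z w) = tr_X (i + j) (z ∪ w)` for `hk : i + j = k`. -/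
theorem tr_cupProduct_congr (hX : IsSmoothProjective n X) {i j k : ℕ} (hk : i + j = k)
    (z : bettiCohomology X i) (w : bettiCohomology X j) :
    BettiUniverse.tr hX k (cupProduct hk z w) = BettiUniverse.tr hX (i + j) (BettiUniverse.cup X i j z w) := by
  subst hk
  rfl

/-- Part 7's `fourierSum_mem_ratAlgebraicClasses` with the cross products `fst^* x_c ∪ snd^* y_c` formed by
`bettiCup hk` INTO a prescribed degree `k` and the coniveau written as a prescribed `e` (`2j + 2s = k`,
`j + s = e`): if `Σ_{c ∈ S} bettiCup hk (fst^* x_c) (snd^* y_c)` complexifies into `Nᵉ Hᵏ((X ⊗ Y)(ℂ))` then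
`Σ_{c ∈ S} tr_X(z ∪ x_c) • y_c ∈ alg Y s` for every `z ∈ alg X p` (`p + j = dim X`). -/
theorem fourierSum_mem_ratAlgebraicClasses_of_sum_mem (hX : IsSmoothProjective n X) (hY : IsSmoothProjective m Y)
    {p j s k e : ℕ} (hpj : p + j = n) (hk : 2 * j + 2 * s = k) (he : j + s = e) {ι : Type*} (S : Finset ι)
    (x : ι → bettiCohomology X (2 * j)) (y : ι → bettiCohomology Y (2 * s))
    (hu : ofRatClass (ComplexPoints (X ⊗ Y)) k
        (∑ c ∈ S, bettiCup hk (BettiUniverse.pull (fst X Y) (2 * j) (x c))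
          (BettiUniverse.pull (snd X Y) (2 * s) (y c))) ∈
      supportedClasses (X ⊗ Y) k e)
    {z : bettiCohomology X (2 * p)} (hz : z ∈ ratAlgebraicClasses X p) :
    ∑ c ∈ S, BettiUniverse.tr hX (2 * p + 2 * j) (BettiUniverse.cup X (2 * p) (2 * j) z (x c)) • y c ∈
      ratAlgebraicClasses Y s := by
  subst hk he
  exact fourierSum_mem_ratAlgebraicClasses hX hY hpj S x y hu hz

/-- **Clause (i) of `Fact_algDuality` at the socket, membership form.**  For `X` smooth projective of dimension
`n`, families `x y : Fin N → H¹(X(ℂ); ℚ)`, degrees `2p + 2q = 2n`, and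
`halg : Σ_{c : Fin (2q) → Fin N} bettiCup (two_mul (2q)).symm (fst^* m_{2q}(x ∘ c)) (snd^* m_{2q}(y ∘ c)) ∈ alg (X ⊗ X) (2q)`
(kernel K-b's output), every `z ∈ alg X p` has `fourierSum hX x y (2q) h z ∈ alg X q`
(part 7: `= r⁻¹ • pr₂_!(pr₁^* z ∪ u)` with `u` the class of `halg`). -/
theorem fourierSum_mem_ratAlgebraicClasses_of_halg (hX : IsSmoothProjective n X) {N : ℕ}
    (x y : Fin N → bettiCohomology X 1) {p q : ℕ} (h : 2 * p + 2 * q = 2 * n)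
    (halg : ∑ c : Fin (2 * q) → Fin N, bettiCup (two_mul (2 * q)).symm
        (BettiUniverse.pull (fst X X) (2 * q) (cupPowOne ℚ (ComplexPoints X) (2 * q) (x ∘ c)))
        (BettiUniverse.pull (snd X X) (2 * q) (cupPowOne ℚ (ComplexPoints X) (2 * q) (y ∘ c))) ∈
      ratAlgebraicClasses (X ⊗ X) (2 * q))
    {z : bettiCohomology X (2 * p)} (hz : z ∈ ratAlgebraicClasses X p) :
    fourierSum hX x y (2 * q) h z ∈ ratAlgebraicClasses X q := by
  have hmem := fourierSum_mem_ratAlgebraicClasses_of_sum_mem hX hX (p := p) (j := q) (s := q)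
    (k := 2 * (2 * q)) (e := 2 * q) (by omega) (by omega) (by omega) Finset.univ
    (fun c ↦ cupPowOne ℚ (ComplexPoints X) (2 * q) (x ∘ c)) (fun c ↦ cupPowOne ℚ (ComplexPoints X) (2 * q) (y ∘ c))
    ((mem_ratAlgebraicClasses_iff _ _ _).1 halg) hz
  rw [fourierSum_apply]
  simp_rw [tr_cupProduct_congr hX h]
  exact hmem

/-- **Clause (i) of `Fact_algDuality` at the socket, operator form**: under the hypotheses of
`fourierSum_mem_ratAlgebraicClasses_of_halg`, `(alg X p).map (fourierSum hX x y (2q) h) ≤ alg X q` — for row M22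
(`q = 2`, `p = dim P − 2`) literally `(U.alg P (d − 2)).map D ≤ U.alg P 2` with `D := fourierSum … 4 h`. -/
theorem ratAlgebraicClasses_map_fourierSum_le_of_halg (hX : IsSmoothProjective n X) {N : ℕ}
    (x y : Fin N → bettiCohomology X 1) {p q : ℕ} (h : 2 * p + 2 * q = 2 * n)
    (halg : ∑ c : Fin (2 * q) → Fin N, bettiCup (two_mul (2 * q)).symm
        (BettiUniverse.pull (fst X X) (2 * q) (cupPowOne ℚ (ComplexPoints X) (2 * q) (x ∘ c)))
        (BettiUniverse.pull (snd X X) (2 * q) (cupPowOne ℚ (ComplexPoints X) (2 * q) (y ∘ c))) ∈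
      ratAlgebraicClasses (X ⊗ X) (2 * q)) :
    (ratAlgebraicClasses X p).map (fourierSum hX x y (2 * q) h) ≤ ratAlgebraicClasses X q := by
  rintro _ ⟨z, hz, rfl⟩
  exact fourierSum_mem_ratAlgebraicClasses_of_halg hX x y h halg hz

end Socket

section Test

variable {n : ℕ} {X : SchemeOver ℂ}

/-- Instantiation check at the numerals of row M22 (not used elsewhere): with `x y : Fin N → H¹`, K-a's
`D := fourierSum hX x y 4 h` (`h : 2(n−2) + 4 = 2n`) and K-b's `halg` for `i = 4` spelled with
`fun k ↦ x (c k)`, clause (i) `(alg X (n−2)).map D ≤ alg X 2` is `ratAlgebraicClasses_map_fourierSum_le_of_halg`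
at `q := 2`. -/
example (hX : IsSmoothProjective n X) {N : ℕ} (x y : Fin N → bettiCohomology X 1)
    (h : 2 * (n - 2) + 4 = 2 * n)
    (halg : ∑ c : Fin 4 → Fin N, bettiCup (two_mul 4).symm
        (BettiUniverse.pull (fst X X) 4 (cupPowOne ℚ (ComplexPoints X) 4 (fun k ↦ x (c k))))
        (BettiUniverse.pull (snd X X) 4 (cupPowOne ℚ (ComplexPoints X) 4 (fun k ↦ y (c k)))) ∈
      ratAlgebraicClasses (X ⊗ X) 4) :
    (ratAlgebraicClasses X (n - 2)).map (fourierSum hX x y 4 h) ≤ ratAlgebraicClasses X 2 :=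
  ratAlgebraicClasses_map_fourierSum_le_of_halg hX x y (p := n - 2) (q := 2) h halg

end Test

end Summit.HodgeConjecture.CorCM.Model

end
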